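import Summits.QuantumFields.BalabanUV.T4Continuum.Support.NE3EnergyRateWSupRoutePi
import Summits.QuantumFields.BalabanUV.T4Continuum.Support.NE3RightInverseLetters
import HarnessLib

/-!
# T⁴ programme, node NE3 — route Π, file 6e: THE END OF ROUTE Π WITH THE LINEAR NORMAL PART BY NAME — `Nn := rightInvW … (dirIter L (j+1) W X₀)`
# (Π-R-W's EXACT curved right inverse) and its letters (R1)–(R5), (R6′) DISCHARGED by `NE3RightInverseLetters`; per pair only the residual slice
# representative, the weight with its local quadratic letter, and three k-free currencies remain

NE3 (node U1b), row NE3 OWNER `b2b-balaban-t4-ne3-p1` (gen 26; g25 HANDOFF «file 6 with `Nn := R_W(D_W X₀)` BY NAME»; ruling ρ-g26-1).  Inputs BY NAME: file 6bγ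
`NE3EnergyRateWSupRoutePi.ne3EnergyRateWSup_sfClass_routePi` (the END of record), leaf-01-g8's Π-R-W W5 `NE3SmoothRightInverseW.rightInvW` and W6z
`NE3RightInverseLetters` (`rightInvW_periodic`, `rightInvW_R1`, `curlSq_rightInvW_le`, `sum_norm_curl_rightInvW_le`, `rightInvW_R4`, `rightInvW_R5`,
`norm_curl_rightInvW_le_perWin`), the class transport `MinimalActionRate.rescale_bavg_mem_sfClass`.

WHAT.  §1 the linearised `k`-fold average of a skew∕periodic direction is skew∕periodic in the multi-level class (`dirIter_skew`, `isPeriodicDir_dirIter`), and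
the END's class family one notch down (`levelSmall_pair`).  §2 **`ne3EnergyRateWSup_sfClass_routePi_rinv`**: the END of record with the right-inverse
constants INSTANTIATED — `c₁ = l2C∕(1−θℓ)²`, `c₂ = curl2C∕(1−θℓ)²`, `c₃ = curl1C∕(1−θℓ)`, `c₄ = l1C∕(1−θℓ)` (`θℓ = thetaLoc d L·ε`), `α̂N = supC·C₂α̂²∕(1−θ)`,
`âN = supCurlC·C₂α̂²∕(1−θ)` (`θ = cruxC d L·ε`) — and the per-pair hypothesis SHRUNK to **`hleaves`**: at every level `j`, datum `V ∈ dom`, minimiser `U_A` of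
run `j+1`, minimiser `U_B` of run `j+2` regular with `(b, g)`, THERE ARE `u, X₀, α₀, m, C` with `X₀` skew, [leaf Π-L1♮]
`ResidualSliceRepT L N (j+1) (cavg L U_B) U_A u X₀ (rightInvW hL j … N … (dirIter L (j+1) (cavg L U_B) X₀)) α₀` (stated for ALL proof arguments of
`rightInvW` — they are propositions, the field does not depend on them), the weight `m ≥ 0`, `0 ≤ C`, `(L^{j+1})^d Σ m² ≤ C²·dirSq X₀`, THE LOCAL QUADRATIC
LETTER `‖dirIter L (j+1) (cavg L U_B) X₀ z κ‖ ≤ C₂((L^{j+1})·m z κ)²` on `periodBox N` [Π-C-3γ over (Π-REG-γ)], and the currencies `α₀·L^{j+1} ≤ α̂`,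
`m·L^{j+1} ≤ α̂`, `C ≤ Ĉ`.  New uniform numeric binders: `thetaLoc d L·ε < 1`, `ε ≤ 1` (W6's regime).

HONEST FRAMING.  A composition of landed∕staged kernel theorems.  REMAINING HYPOTHESES OF THE LOCAL HALF OF NE3 ON THE FIXED TORUS after this file: per pair
the TYPED LEAF Π-L1♮ (existence of the R-adapted residual slice representative — B11 Prop 2 TYPE-analogue, ours in form), the weight + local quadratic letter
(kernel supplier Π-C-3γ over the TYPED LEAF (Π-REG-γ), leaf-02 lineage, in flight), (H∃) downstream, and displayed k-free numeric lines; NO chart, NO path,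
NO fixed point, NO (ML_w), NO (P♮)_W, NO class∕window∕fibre datum, NO letter of the normal part.  T-E_w♯ and NE3 are NOT proved; spine PROVED 0∕9; finite
T⁴ rung (B)+1 — NOT infinite volume, NOT mass gap, NOT `BetaPertH`, NOT Clay.  PLACEMENT: `Summits/QuantumFields/BalabanUV/`.  HONEST DEPENDENCY: continuum
YM on T⁴ ⇐ BetaPertH ∧ nine spine estimates (0/9 proved); BetaPertH ⇐ (D1) ∧ (D4) ∧ CAP+tail; G-an2-4 gates asym, D1 and NE2/3/4.
-/

set_option autoImplicit false

open scoped BigOperators Matrix.Norms.L2Operator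
open NormedSpace Finset

namespace Summit.QuantumFields.BalabanUV.T4Continuum.NE3EnergyRateWSupRoutePiRInv

open Set
open Literature.MathematicalPhysics.QuantumFieldTheory.Balaban1983to89
open B7Prop1Explicit B7Prop2Explicit
open T4AveragingDeficitWall hiding Site Plane Plaq Bond
open T4AveragingDeficitWallBoundary (IsPeriodicCfg periodBox)
open AveragingDeficitPeriodicCounting (IsPeriodicDir)
open AveragingDeficitChartCalculus (cavg)
open AveragingDeficitTwoLevelPrep (prop1Radius)
open AveragingDeficitMultiLevelPrep (LevelSmall tower natCast_tower_succ isPeriodicDir_cpush)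
open AveragingDeficitFermat (isPeriodicCfg_cavg boxVec_redN_mem)
open AveragingDeficitTorusChart (extDir resDir extDir_resDir)
open NE3CovariantLineSumsL2 (C2sq)
open NE3CovariantLineSumsL2Tower (rho)
open NE3CovariantLineSumsError (sq_mul_le_prop1Radius)
open MinimalActionLevels (perWin)
open MinimalActionRate (sfClass Regular rescale_bavg_mem_sfClass)
open MinimalActionSandwich (IsMinimiser)
open NE3TangentCovariantTower (dirIter step_small)
open NE3QuadRemainderTower (cpush_skew)
open NE3EnergyWeightedSupShape (NE3EnergyRateWSup)
open NE3EnergyRateWSupOfSlicePoincare (cLambda)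
open NE3SlicePoincareBudgetLine (ShLine SmallYLine CPLine)
open NE3DecomposedRepOfLinearNormalPart (ResidualSliceRepT)
open NE3DecomposedRepSfClass (levelRadius_rescale)
open NE3EnergyRateWSupRoutePi (piRad piNu piKappa1 piKappa2 ne3EnergyRateWSup_sfClass_routePi)
open NE3QbarIterCovLiftPrep (cruxC liftC_nonneg)
open NE3SmoothRightInverseW (rightInvW)
open NE3RightInverseSupLetters (supC)
open NE3RightInverseSolveLetters (thetaLoc)
open NE3RightInverseL2Letter (l2C l2C_nonneg)
open NE3RightInverseL1Letter (l1C l1C_nonneg)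
open NE3HatInvCurlLetters (supCurlC curl2C curl1C curl2C_nonneg curl1C_nonneg)
open NE3RightInverseLetters (rightInvW_periodic rightInvW_R1 curlSq_rightInvW_le sum_norm_curl_rightInvW_le rightInvW_R4 rightInvW_R5
  norm_curl_rightInvW_le_perWin)

noncomputable section

variable {d : ℕ} {n : Type*} [Fintype n] [DecidableEq n]

/-! ## §1 The linearised average of a skew ∕ periodic direction; the class family at a pair -/

/-- **THE LINEARISED `(j+1)`-FOLD AVERAGE OF A SKEW DIRECTION IS SKEW** in the multi-level small-field class (induction through the tower; each step is
`NE3QuadRemainderTower.cpush_skew`, the backgrounds stay in the class by `step_small`). [folklore] -/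
theorem dirIter_skew [Nonempty n] {L : ℕ} (hL : 1 ≤ L) (j : ℕ) :
    ∀ {W : Site d → Fin d → (Matrix n n ℂ)ˣ} {x : ℝ}, IsUnitaryCfg W → 0 ≤ x → LevelSmall d L j x → SmallField W x →
      ∀ {Y : Site d → Fin d → Matrix n n ℂ}, IsSkewDir Y → IsSkewDir (dirIter L (j + 1) W Y) := by
  induction j with
  | zero =>
      intro W x hWu hx hs hWx Y hY
      obtain ⟨h512, -, -, -⟩ := step_small hL hWu hx hs hWx
      exact cpush_skew hL hWu hx h512 hWx hY
  | succ j ih =>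
      intro W x hWu hx hs hWx Y hY
      obtain ⟨h512, hW₁u, hr0, hW₁x⟩ := step_small hL hWu hx hs.1 hWx
      exact ih hW₁u hr0 hs.2 hW₁x (cpush_skew hL hWu hx h512 hWx hY)

/-- **THE LINEARISED `m`-FOLD AVERAGE OF A PERIODIC DIRECTION IS PERIODIC**: period `tower L P m` at the base gives period `P` after `m` levels. [folklore] -/
theorem isPeriodicDir_dirIter (L P : ℕ) : ∀ (m : ℕ) {W : Site d → Fin d → (Matrix n n ℂ)ˣ} {Y : Site d → Fin d → Matrix n n ℂ},
    IsPeriodicCfg W ((tower L P m : ℕ) : ℤ) → IsPeriodicDir Y ((tower L P m : ℕ) : ℤ) → IsPeriodicDir (dirIter L m W Y) (P : ℤ)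
  | 0, _, _, _, hY => hY
  | m + 1, W, Y, hW, hY => by
      rw [natCast_tower_succ] at hW hY
      exact isPeriodicDir_dirIter L P m (isPeriodicCfg_cavg L _ hW) (isPeriodicDir_cpush L _ hW hY)

/-- A bound on the period box of an `N`-periodic direction holds everywhere. [folklore] -/
theorem forall_norm_le_of_periodBox {N : ℕ} [NeZero N] {φ : Site d → Fin d → Matrix n n ℂ} (hφP : IsPeriodicDir φ (N : ℤ)) {s : ℝ}
    (h : ∀ z ∈ periodBox (d := d) N, ∀ κ : Fin d, ‖φ z κ‖ ≤ s) : ∀ (z : Site d) (κ : Fin d), ‖φ z κ‖ ≤ s := by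
  intro z κ
  have e := congrFun (congrFun (extDir_resDir N hφP) z) κ
  rw [← e]
  exact h _ (boxVec_redN_mem N z) κ

/-- The END's class family read at a pair: `LevelSmall d L j (ε∕(L^{j+1})²)` from `LevelSmall d L (j+1) (ε∕(L^{j+2})²)` (one notch of `prop1Radius`,
as in `NE3ClassSlicePoincare.classSlicePoincare_of_lines`). [folklore] -/
theorem levelSmall_pair {L : ℕ} (hL : 1 ≤ L) {ε : ℝ} (hε : 0 ≤ ε) (hsmall : ∀ j : ℕ, LevelSmall d L (j + 1) (ε / ((L : ℝ) ^ (j + 2)) ^ 2)) (j : ℕ) :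
    LevelSmall d L j (ε / ((L : ℝ) ^ (j + 1)) ^ 2) := by
  have hL0 : (0 : ℝ) < L := by exact_mod_cast (show 0 < L by omega)
  have hx : 0 ≤ ε / ((L : ℝ) ^ (j + 1)) ^ 2 := by positivity
  have hxy : ε / ((L : ℝ) ^ (j + 1)) ^ 2 ≤ prop1Radius d L (ε / ((L : ℝ) ^ (j + 2)) ^ 2) := by
    have e : ε / ((L : ℝ) ^ (j + 1)) ^ 2 = (L : ℝ) ^ 2 * (ε / ((L : ℝ) ^ (j + 2)) ^ 2) := by
      field_simp; ring
    rw [e]; exact sq_mul_le_prop1Radius (d := d) L _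
  exact AveragingDeficitMultiLevelPrep.LevelSmall.mono (d := d) hx hxy (hsmall j).2

/-! ## §2 THE END of route Π with the right inverse by name -/

/-- **T-E_w♯ OVER `sfClass` FROM THE RESIDUAL SLICE REPRESENTATIVE ADAPTED TO THE EXACT RIGHT INVERSE, THE LOCAL QUADRATIC LETTER AND k-FREE CURRENCIES —
the letters of the linear normal part are theorems.**  See the module docstring; `θ₀ = piNu + 23√2√(16d+1)(1+piNu)` with
`piNu = piNu d (l2C∕(1−θℓ)²) (curl2C∕(1−θℓ)²) C₂ Ĉ α̂`. [folklore] -/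
theorem ne3EnergyRateWSup_sfClass_routePi_rinv [Nonempty n] (hd : 3 ≤ d) {L N : ℕ} [NeZero L] [NeZero N] (hL : 2 ≤ L) (hN : 1 ≤ N)
    {ε b g : ℝ} (hb : 0 ≤ b) (hbε : b < ε) (hg : 0 < g)
    (hbs : 512 * (d + 1) * (d + 4) * (L : ℝ) ^ 2 * b ≤ 1) (hbε' : b + 226 * (8 * (d + 1) * (d + 4)) ^ 2 * b ^ 2 ≤ ε)
    (hsmall : ∀ j : ℕ, LevelSmall d L (j + 1) (ε / ((L : ℝ) ^ (j + 2)) ^ 2))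
    -- the K-road lines of (P♮)_W
    {dom : Set (Site d → Fin d → (Matrix n n ℂ)ˣ)} {θK εc : ℝ} (hε : 0 < ε) (hεθ : ε ≤ θK) (hεc : 0 < εc)
    (hK1 : ShLine d L (Fintype.card n) εc θK ≤ 1 / 2) (hK2 : SmallYLine d L (Fintype.card n) εc θK ≤ 1 / 2)
    (hK3 : 68 / 3 * (((d : ℝ) + 1) * ((d : ℝ) + 4)) * C2sq d L * θK ≤ rho d L / 2)
    (hK4 : 8 * d * (((d : ℝ) - 1) * θK) ^ 2
      + 2 * ((Fintype.card n : ℝ) * ((4 * (d : ℝ) ^ 2 + 272 * d * (((d : ℝ) + 1) * ((d : ℝ) + 4))) * θK) ^ 2) ≤ 1 / 2)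
    -- the right inverse's regime (W5∕W6): `cruxC·ε ≤ thetaLoc·ε < 1`, `ε ≤ 1`
    (hθl : thetaLoc d L * ε < 1) (hε1 : ε ≤ 1)
    -- route Π: the quadratic-letter constant, the currencies' ceilings and FOUR uniform lines
    {C₂ αh Ch Λ : ℝ} (hC₂ : 0 ≤ C₂) (hαh0 : 0 ≤ αh) (hCh0 : 0 ≤ Ch)
    (hℓ₁ : αh ≤ 1 / 100) (hℓ₃ : supC d L * (C₂ * αh ^ 2) / (1 - cruxC d L * ε) ≤ 1 / 2700)
    (hℓ₄ : 10 * (αh + 24 * (supC d L * (C₂ * αh ^ 2) / (1 - cruxC d L * ε))) ≤ 1)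
    (hℓ₅ : 2 * (l2C d L / (1 - thetaLoc d L * ε) ^ 2 + curl2C d L / (1 - thetaLoc d L * ε) ^ 2) * C₂ ^ 2 * Ch ^ 2 * αh ^ 2 ≤ 1 / 2)
    -- the level lines (J1)(J2), the regularity and budget lines of the END
    (hCP : 0 ≤ CPLine d L (Fintype.card n) εc θK)
    (hJ1 : (1 + 480 * Real.sqrt d * (αh + 24 * (supC d L * (C₂ * αh ^ 2) / (1 - cruxC d L * ε)))) ^ 2
      + 48 * d * piRad ε αh (supC d L * (C₂ * αh ^ 2) / (1 - cruxC d L * ε)) (supCurlC d L * (C₂ * αh ^ 2) / (1 - cruxC d L * ε)) ≤ Λ)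
    (hJ2 : 112 * (d : ℝ) * piRad ε αh (supC d L * (C₂ * αh ^ 2) / (1 - cruxC d L * ε)) (supCurlC d L * (C₂ * αh ^ 2) / (1 - cruxC d L * ε))
      * CPLine d L (Fintype.card n) εc θK ≤ 1 / (2 * (Fintype.card n : ℝ)))
    (hreg₁ : CPLine d L (Fintype.card n) εc θK * (Real.sqrt Λ - 1) ^ 2 ≤ 1 / 4)
    (hbudget : 2 * Λ * (2 * (1 + 4 * Real.sqrt (16 * d + 1))
          * piNu d (l2C d L / (1 - thetaLoc d L * ε) ^ 2) (curl2C d L / (1 - thetaLoc d L * ε) ^ 2) C₂ Ch αh)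
        + Λ * (2 * (1 + 4 * Real.sqrt (16 * d + 1))
          * piNu d (l2C d L / (1 - thetaLoc d L * ε) ^ 2) (curl2C d L / (1 - thetaLoc d L * ε) ^ 2) C₂ Ch αh) ^ 2
        + (2 * piKappa1 d (curl1C d L / (1 - thetaLoc d L * ε)) (l1C d L / (1 - thetaLoc d L * ε)) C₂ Ch ε αh
              (supC d L * (C₂ * αh ^ 2) / (1 - cruxC d L * ε)) (supCurlC d L * (C₂ * αh ^ 2) / (1 - cruxC d L * ε))
          + 912 * d * piKappa2 (l1C d L / (1 - thetaLoc d L * ε)) C₂ Ch ε αh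
              (supC d L * (C₂ * αh ^ 2) / (1 - cruxC d L * ε)) (supCurlC d L * (C₂ * αh ^ 2) / (1 - cruxC d L * ε))) + 2 * 0
      ≤ cLambda n (CPLine d L (Fintype.card n) εc θK) Λ / 2)
    -- THE RESIDUAL SLICE REPRESENTATIVE ADAPTED TO THE EXACT RIGHT INVERSE, THE WEIGHT WITH ITS QUADRATIC LETTER, THE CURRENCIES — per pair
    (hleaves : ∀ j : ℕ, ∀ V ∈ dom, ∀ UA UB : Site d → Fin d → (Matrix n n ℂ)ˣ,
      IsMinimiser d (sfClass d L N ε) L N (j + 1) V UA → IsMinimiser d (sfClass d L N ε) L N (j + 2) V UB →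
        Regular d L N b g (j + 2) UB →
        ∃ (u : Site d → (Matrix n n ℂ)ˣ) (X₀ : Site d → Fin d → Matrix n n ℂ) (α₀ : ℝ) (m : Site d → Fin d → ℝ) (C : ℝ),
          IsSkewDir X₀ ∧
          (∀ (hWu : IsUnitaryCfg (cavg L UB)) (hx : 0 ≤ ε / ((L : ℝ) ^ (j + 1)) ^ 2) (hs : LevelSmall d L j (ε / ((L : ℝ) ^ (j + 1)) ^ 2))
              (hWx : SmallField (cavg L UB) (ε / ((L : ℝ) ^ (j + 1)) ^ 2))
              (hθ : cruxC d L * (((L : ℝ) ^ (j + 1)) ^ 2 * (ε / ((L : ℝ) ^ (j + 1)) ^ 2)) < 1)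
              (hφ : IsSkewDir (dirIter L (j + 1) (cavg L UB) X₀)),
            ResidualSliceRepT L N (j + 1) (cavg L UB) UA u X₀ (rightInvW hL j hWu hx hs hWx N hθ hφ) α₀) ∧
          (∀ z κ, 0 ≤ m z κ) ∧ 0 ≤ C ∧
          ((L : ℝ) ^ (j + 1)) ^ d * ∑ z ∈ periodBox (d := d) N, ∑ κ : Fin d, m z κ ^ 2
            ≤ C ^ 2 * dirSq X₀ (periodBox (d := d) (N * L ^ (j + 1))) ∧
          (∀ z ∈ periodBox (d := d) N, ∀ κ : Fin d,
            ‖dirIter L (j + 1) (cavg L UB) X₀ z κ‖ ≤ C₂ * ((L : ℝ) ^ (j + 1) * m z κ) ^ 2) ∧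
          α₀ * (L : ℝ) ^ (j + 1) ≤ αh ∧ (∀ z κ, m z κ * (L : ℝ) ^ (j + 1) ≤ αh) ∧ C ≤ Ch) :
    NE3EnergyRateWSup d (sfClass d L N ε) L N b g
      ((1 + (piNu d (l2C d L / (1 - thetaLoc d L * ε) ^ 2) (curl2C d L / (1 - thetaLoc d L * ε) ^ 2) C₂ Ch αh
          + 23 * Real.sqrt 2 * Real.sqrt (16 * d + 1)
            * (1 + piNu d (l2C d L / (1 - thetaLoc d L * ε) ^ 2) (curl2C d L / (1 - thetaLoc d L * ε) ^ 2) C₂ Ch αh)))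
        * (4 / cLambda n (CPLine d L (Fintype.card n) εc θK) Λ)
        * (Real.sqrt ((L : ℝ) ^ (d - 2))
            + (Real.sqrt ((L : ℝ) ^ (d - 2)) * Real.sqrt (8 * Fintype.card (T4AveragingDeficitWall.Plane d))
                * (128 * (d * (L : ℝ) ^ 2))
              + 2 * (2048 * ((d : ℝ) + 4) ^ 2 * (L : ℝ) ^ 2 * Real.sqrt (d * (L : ℝ) ^ d))) * b
            + b ^ 2 * (2 * (L : ℝ) ^ (d - 1) + 2 * (8 * d * (L : ℝ) ^ d)) * Real.sqrt (d / (g * (L : ℝ) ^ (d + 2)))))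
      ((Real.sqrt Λ - 1) / (24 * Real.sqrt d)) dom := by
  have hL1 : 1 ≤ L := by omega
  have hL1r : (1 : ℝ) ≤ L := by exact_mod_cast hL1
  -- the W6 regime numerics
  have hcrux0 : 0 ≤ cruxC d L := NE3RightInverseSolveLetters.cruxC_nonneg d L
  have hθc : cruxC d L * ε < 1 :=
    lt_of_le_of_lt (mul_le_mul_of_nonneg_right (NE3RightInverseSolveLetters.cruxC_le_thetaLoc d L) hε.le) hθl
  have h1θ : 0 < 1 - cruxC d L * ε := by linarith
  have h1θl : 0 < 1 - thetaLoc d L * ε := by linarith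
  have hsupC0 : 0 ≤ supC d L := by
    unfold supC NE3RightInverseSupLetters.corrC NE3RightInverseSupLetters.frameC; have := liftC_nonneg d; positivity
  have hsupCurlC0 : 0 ≤ supCurlC d L := by
    unfold supCurlC NE3RightInverseSupLetters.frameC; have := liftC_nonneg d; positivity
  have hc₁ : 0 ≤ l2C d L / (1 - thetaLoc d L * ε) ^ 2 := by have := l2C_nonneg d L; positivity
  have hc₂ : 0 ≤ curl2C d L / (1 - thetaLoc d L * ε) ^ 2 := by have := curl2C_nonneg d L; positivity
  have hc₃ : 0 ≤ curl1C d L / (1 - thetaLoc d L * ε) := by have := curl1C_nonneg d L; positivity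
  have hc₄ : 0 ≤ l1C d L / (1 - thetaLoc d L * ε) := by have := l1C_nonneg d L; positivity
  refine ne3EnergyRateWSup_sfClass_routePi hd hL hN hb hbε hg hbs hbε' hsmall hε hεθ hεc hK1 hK2 hK3 hK4 hC₂ hc₁ hc₂ hc₃ hc₄ hαh0 hCh0
    hℓ₁ hℓ₃ hℓ₄ hℓ₅ hCP hJ1 hJ2 hreg₁ hbudget ?_
  intro j V hV UA UB hA hB hreg
  obtain ⟨u, X₀, α₀, m, C, hXs, hrep, hm0, hC, hsq, hφq, hαh, hmh, hCh⟩ := hleaves j V hV UA UB hA hB hreg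
  -- the class data of the background `W = cavg L U_B` and the radius identities
  have hcl : cavg L UB ∈ sfClass d L N ε (j + 1) := rescale_bavg_mem_sfClass hL1 hb hbs hbε' hreg
  obtain ⟨hWu, hWP, hWx⟩ := hcl
  have hT : ((tower L N (j + 1) : ℕ) : ℤ) = ((N * L ^ (j + 1) : ℕ) : ℤ) := by
    rw [NE3FramePotBoundW.tower_eq_pow_mul, Nat.mul_comm]
  have hWPt : IsPeriodicCfg (cavg L UB) ((tower L N (j + 1) : ℕ) : ℤ) := by rw [hT]; exact hWP
  have hx : 0 ≤ ε / ((L : ℝ) ^ (j + 1)) ^ 2 := by positivity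
  have hs : LevelSmall d L j (ε / ((L : ℝ) ^ (j + 1)) ^ 2) := levelSmall_pair hL1 hε.le hsmall j
  have hxM : ((L : ℝ) ^ (j + 1)) ^ 2 * (ε / ((L : ℝ) ^ (j + 1)) ^ 2) = ε := (levelRadius_rescale hL1 ε j).2
  have hM0 : 0 < (L : ℝ) ^ (j + 1) := by positivity
  have hM1 : 1 ≤ (L : ℝ) ^ (j + 1) := one_le_pow₀ hL1r
  have hθ : cruxC d L * (((L : ℝ) ^ (j + 1)) ^ 2 * (ε / ((L : ℝ) ^ (j + 1)) ^ 2)) < 1 := by rw [hxM]; exact hθc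
  have hθlM : thetaLoc d L * (((L : ℝ) ^ (j + 1)) ^ 2 * (ε / ((L : ℝ) ^ (j + 1)) ^ 2)) < 1 := by rw [hxM]; exact hθl
  have hεM : ((L : ℝ) ^ (j + 1)) ^ 2 * (ε / ((L : ℝ) ^ (j + 1)) ^ 2) ≤ 1 := by rw [hxM]; exact hε1
  -- the coarse datum `φ := dirIter L (j+1) W X₀`: skew, `N`-periodic, sup `C₂·α̂²`
  have hφs : IsSkewDir (dirIter L (j + 1) (cavg L UB) X₀) := dirIter_skew hL1 j hWu hx hs hWx hXs
  have h := hrep hWu hx hs hWx hθ hφs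
  have hXP : IsPeriodicDir X₀ ((tower L N (j + 1) : ℕ) : ℤ) := by rw [hT]; exact h.per
  have hφP : IsPeriodicDir (dirIter L (j + 1) (cavg L UB) X₀) (N : ℤ) := isPeriodicDir_dirIter L N (j + 1) hWPt hXP
  have hs0 : 0 ≤ C₂ * αh ^ 2 := by positivity
  have hφsup : ∀ (z : Site d) (κ : Fin d), ‖dirIter L (j + 1) (cavg L UB) X₀ z κ‖ ≤ C₂ * αh ^ 2 := by
    refine forall_norm_le_of_periodBox hφP fun z hz κ => (hφq z hz κ).trans ?_
    have h1 : (L : ℝ) ^ (j + 1) * m z κ ≤ αh := by have h' := hmh z κ; rwa [mul_comm] at h'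
    have h0 : 0 ≤ (L : ℝ) ^ (j + 1) * m z κ := mul_nonneg hM0.le (hm0 z κ)
    exact mul_le_mul_of_nonneg_left (pow_le_pow_left₀ h0 h1 2) hC₂
  -- the letters of `Nn := rightInvW … φ` (W6z), radius identities rewritten to `ε`
  have hNP := rightInvW_periodic hL j hWu hWPt hx hs hWx hθ hφs
  have hR1 := rightInvW_R1 hL j hWu hWPt hx hs hWx hθ hθlM hεM hφs
  have hR2 := curlSq_rightInvW_le hL j hWu hWPt hx hs hWx hθ hθlM hεM hφs
  have hR3 := sum_norm_curl_rightInvW_le hL j hWu hWPt hx hs hWx hθ hθlM hεM hφs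
  have hR4 := rightInvW_R4 hL j hWu hWPt hx hs hWx hθ hθlM hεM hφs
  have hR5 := rightInvW_R5 (N := N) hL j hWu hx hs hWx hθ hεM hφs hs0 hφsup
  have hR6 := norm_curl_rightInvW_le_perWin (N := N) hL j hWu hx hs hWx hθ hεM hφs hs0 hφsup
  rw [hxM] at hR1 hR2 hR3 hR4 hR5 hR6
  -- the sup and window sup-curl sizes and their currencies
  have hαN0 : 0 ≤ supC d L / ((L : ℝ) ^ (j + 1) * (1 - cruxC d L * ε)) * (C₂ * αh ^ 2) := by positivity
  have haN0 : 0 ≤ supCurlC d L / (((L : ℝ) ^ (j + 1)) ^ 2 * (1 - cruxC d L * ε)) * (C₂ * αh ^ 2) := by positivity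
  have hαNh : supC d L / ((L : ℝ) ^ (j + 1) * (1 - cruxC d L * ε)) * (C₂ * αh ^ 2) * (L : ℝ) ^ (j + 1)
      ≤ supC d L * (C₂ * αh ^ 2) / (1 - cruxC d L * ε) := by
    apply le_of_eq; field_simp
  have haNh : supCurlC d L / (((L : ℝ) ^ (j + 1)) ^ 2 * (1 - cruxC d L * ε)) * (C₂ * αh ^ 2) * ((L : ℝ) ^ (j + 1)) ^ 2
      ≤ supCurlC d L * (C₂ * αh ^ 2) / (1 - cruxC d L * ε) := by
    apply le_of_eq; field_simp
  exact ⟨u, X₀, _, α₀, m, C, _, _, h, hm0, hC, hsq, hφq, hNP, hαN0, hR5, haN0, hR6, hR1, hR2, hR3, hR4, hαh, hmh, hCh, hαNh, haNh⟩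

end

end Summit.QuantumFields.BalabanUV.T4Continuum.NE3EnergyRateWSupRoutePiRInv
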